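/-
Copyright (c) 2026 the pub-hodgecm-mathlib formalisation cell (harness21).  Prover seat hodgecm-mathlib-LH4-p11 (g5), req620 Track A «(D-RAM) FOUR-FRAME» squad
(unit U2H_HSide, the (ρ2b′-X) road :418; bottom socket (A): the (H)-branch kill on type (A)).
-/
import Literature.NumberTheory.Automorphic.QuadraticDatumRamificationLink   -- ★ p857779 `root_sum_and_prod`, the (i)/(ii) impossibilities; brings the Valued ↔ ValuativeRel bridge
import Summits.HodgeConjecture.HodgeConjecture.Theorems.F0P3cDyRamHSideDescentRatio   -- ★ LH4-p09 (g5): `r₀ = μ − μ⁻¹`, `Θ(ρ r₀) = r₀`, `r₀² = jE((t²−4D)t²∕D²)`, the descent of `Δ·tr²∕det²`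
import HarnessLib

/-!
# Crux `H413`, line LH4 «(D-RAM) FOUR-FRAME» — the (ρ2b′-X) road, bottom socket (A): NO EISENSTEIN DATUM WHEN `|ι y| = |y|²` AND `√D` LIES IN A SUBFIELD OF EVEN VALUATION

Cell `hodgecm-mathlib` (D-0151), FLOOR 0, crux item H413 = `stmt-HodgeConjecture-24833`; squad F0∕P3c∕LH4; bottom socket (A) (dealer MAP v3, payer LH4-p14).  The H-side organ ★
`hSide_closedForm_of_tube_exists` returns a disjunction INERT ∨ EISENSTEIN for the descent datum `Δ_g = (u² + 4w)·z²` of the `U(Φ₂)`-block; socket (A)'s right-hand side is the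
INERT law, so the (A) head must refute the EISENSTEIN disjunct.  ★ p857779 kills it when `ι : F → K = F(√D)` is an ISOMETRY (`e = 1`, route (a) through the global third field).  On type (A)
the square root `r₀ = μ − μ⁻¹` (★ LH4-p09 `F0P3cDyRamHSideDescentRatio`) lives in `M = E′_{w₁}` with `|ι y|_M = |y|_v²` (`e(M∕F_v) = 2`) and is fixed by `τ = Θρ`, whose fixed
field is the UNRAMIFIED quadratic of `F_v` (type (A): `M∕E` unramified and `Θ̄ = ρ̄` on `k_M`) — so every non-zero `τ`-fixed element has EVEN `M`-valuation (the socket letter `hK3`).  THIS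
file is the third impossibility in ★ p857779's row: **(iii) `|ι y| = |y|²`, `τ ∘ ι = ι`, `τ r = r`, no `τ`-fixed element of valuation `exp(−1)`, Eisenstein datum ⇒ `False`** — the root
`θ = (ιu + r∕ιz)∕2` is `τ`-fixed with `|θ|·|θ′| = |ιw| = exp(−2)` and `|θ + θ′| = |ιu| ≤ exp(−2)`, whence `|θ| = exp(−1)`.  And §2 supplies the parity letter LOCALLY: **if every
integer of `K` is within `< 1` of a `τ`-fixed integer and `τ ≠ id`, then no `τ`-fixed element has valuation `exp(−1)`** (a fixed uniformiser would give `|τm − m| ≤ exp(−k)` for all `k`).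
On type (A) the residue hypothesis holds with the `τ`-fixed unit `α′ = α·ρ(Θα)` (LH4-p14's generator) and ★ residue approximation along `F_v → L_w`.  Generic `ℤᵐ⁰`-valued fields; a
`ValuativeRel` bridge version in the letters of the (H) organ's output.
THEOREMS ONLY (no `def`, no instance, no notation, no `sorry`, default heartbeats); lane `--supports stmt-HodgeConjecture-24833 --as helper` (count-neutral).
HONEST LABEL.  Count-neutral; nothing printed is asserted; (ρ2b′-X) stays OPEN; `HC_CM` is proved only modulo the 7 printed citations (2 remaining named inputs: hLiu418 =
`stmt-HodgeConjecture-24832`, h413 = `stmt-HodgeConjecture-24833`) until rung 0 closes.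

## References
* [Serre1979] J.-P. Serre, *Local Fields*, GTM 67 (1979), Ch. I §6 Prop. 17–18 (Eisenstein polynomials, totally ramified extensions), Ch. III §5.
* [LabesseLanglands1979] J.-P. Labesse, R. P. Langlands, *L-indistinguishability for SL(2)*, Canad. J. Math. 31 (1979), §2 p. 8 (the tori `T` of `SL(2)` by quadratic data).
* [NeukirchANT1999] J. Neukirch, *Algebraic Number Theory*, Grundlehren 322 (1999), Ch. II §4 Prop. (4.3) (residue fields along a totally ramified extension).
-/

set_option autoImplicit false

noncomputable section

open scoped Valued WithZero
open WithZero

namespace Summit.HodgeConjecture.HodgeConjecture.Cruxes.H413.F0P3cDyRamTypeASelector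

open Literature.NumberTheory.Automorphic Literature.NumberTheory.Automorphic.HermitianLatticeTree

section Valued

variable {F K : Type*} [Field F] [Field K] [Valued F ℤᵐ⁰] [Valued K ℤᵐ⁰]

/-- In `ℤᵐ⁰`: `x < 1 ⇒ x² ≤ exp(−2)`. [cite: Serre1979, Ch. I §6] -/
theorem sq_le_exp_neg_two_of_lt_one {x : ℤᵐ⁰} (hx : x < 1) : x ^ 2 ≤ exp (-2 : ℤ) := by
  by_cases h0 : x = 0
  · rw [h0, zero_pow two_ne_zero]; exact zero_le
  · rw [← exp_log h0, ← exp_zero, exp_lt_exp] at hx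
    rw [← exp_log h0, ← exp_nsmul, exp_le_exp]; simp only [nsmul_eq_mul, Nat.cast_ofNat]; omega

/-- Two non-zero values of `ℤᵐ⁰` with product `exp(−2)` and `max ≤ exp(−2)` do not exist unless they are EQUAL, and then both are `exp(−1)`. [cite: Serre1979, Ch. I §6 Prop. 17] -/
theorem eq_exp_neg_one_of_mul_eq_of_add_le {a b : ℤᵐ⁰} (ha : a ≠ 0) (hb : b ≠ 0) (hab : a * b = exp (-2 : ℤ)) (hmax : a ≠ b → max a b ≤ exp (-2 : ℤ)) :
    a = exp (-1 : ℤ) := by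
  have hab' : log a + log b = -2 := by
    rwa [← exp_log ha, ← exp_log hb, ← exp_add, exp_inj] at hab
  by_cases h : a = b
  · have hb' : log b = log a := by rw [h]
    rw [← exp_log ha]; congr 1; omega
  · have hm := hmax h
    have h1 : log a ≤ -2 := by have := (le_max_left _ _).trans hm; rwa [← exp_log ha, exp_le_exp] at this
    have h2 : log b ≤ -2 := by have := (le_max_right _ _).trans hm; rwa [← exp_log hb, exp_le_exp] at this
    omega

/-- **(iii) AN EISENSTEIN DATUM OF `D` IS IMPOSSIBLE WHEN `|ι y| = |y|²` AND `√(ιD)` IS FIXED BY AN `ι`-TRIVIAL ENDOMORPHISM WHOSE NON-ZERO FIXED POINTS HAVE EVEN VALUATION.**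
`ι : F →+* K` with `|ι y| = |y|²`, `τ : K →+* K` with `τ ∘ ι = ι` and `τ x = x ≠ 0 ⇒ |x| ∈ exp(2ℤ)`, `r ∈ K` with `τ r = r`, `r² = ι D`, `D = (u² + 4w)·z²` (`z ≠ 0`, `2 ≠ 0` in `K`),
`|u| < 1`, `|w| = exp(−1)`: contradiction — the `τ`-fixed root `θ = (ιu + r∕ιz)∕2` of `X² − ιu·X − ιw` has `|θ| = exp(−1)`. [cite: Serre1979, Ch. I §6 Prop. 17–18] [cite: LabesseLanglands1979, §2 p. 8] -/
theorem false_of_eisenstein_of_sq_of_fixed_ne (ι : F →+* K) (hι : ∀ y, Valued.v (ι y) = Valued.v y ^ 2) (h2 : (2 : K) ≠ 0)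
    (τ : K →+* K) (hτι : ∀ y, τ (ι y) = ι y) (hodd : ∀ x : K, τ x = x → Valued.v x ≠ exp (-1 : ℤ))
    {D u w z : F} (hD : (u ^ 2 + 4 * w) * z ^ 2 = D) (hz : z ≠ 0) (hu : Valued.v u < 1) (hw : Valued.v w = exp (-1 : ℤ))
    {r : K} (hτr : τ r = r) (hr : r ^ 2 = ι D) : False := by
  obtain ⟨hsum, hprod⟩ := root_sum_and_prod ι h2 hD hz hr
  set θ : K := (ι u + r / ι z) / 2 with hθ
  set θ' : K := ι u - (ι u + r / ι z) / 2 with hθ'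
  have hvprod : Valued.v θ * Valued.v θ' = exp (-2 : ℤ) := by
    rw [← map_mul, hprod, Valuation.map_neg, hι, hw, ← exp_nsmul]; congr 1
  have hθ0 : Valued.v θ ≠ 0 := fun h => by rw [h, zero_mul] at hvprod; exact (exp_ne_zero hvprod.symm).elim
  have hθ'0 : Valued.v θ' ≠ 0 := fun h => by rw [h, mul_zero] at hvprod; exact (exp_ne_zero hvprod.symm).elim
  have hvsum : Valued.v θ ≠ Valued.v θ' → max (Valued.v θ) (Valued.v θ') ≤ exp (-2 : ℤ) := fun hne => by
    rw [← Valuation.map_add_of_distinct_val _ hne, hsum, hι]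
    exact sq_le_exp_neg_two_of_lt_one hu
  have hvθ : Valued.v θ = exp (-1 : ℤ) := eq_exp_neg_one_of_mul_eq_of_add_le hθ0 hθ'0 hvprod hvsum
  have hτθ : τ θ = θ := by
    simp only [hθ, map_div₀, map_add, hτι, hτr, map_ofNat]
  exact hodd θ hτθ hvθ

/-- **(iii-even)**: the same with the parity letter `τ x = x ≠ 0 ⇒ |x| ∈ exp(2ℤ)` (the shape of the type-(B) letter ★ `hΘev`). [cite: Serre1979, Ch. I §6 Prop. 17–18] -/
theorem false_of_eisenstein_of_sq_of_fixed_even (ι : F →+* K) (hι : ∀ y, Valued.v (ι y) = Valued.v y ^ 2) (h2 : (2 : K) ≠ 0)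
    (τ : K →+* K) (hτι : ∀ y, τ (ι y) = ι y) (heven : ∀ x : K, τ x = x → x ≠ 0 → ∃ n : ℤ, Valued.v x = exp (2 * n))
    {D u w z : F} (hD : (u ^ 2 + 4 * w) * z ^ 2 = D) (hz : z ≠ 0) (hu : Valued.v u < 1) (hw : Valued.v w = exp (-1 : ℤ))
    {r : K} (hτr : τ r = r) (hr : r ^ 2 = ι D) : False := by
  refine false_of_eisenstein_of_sq_of_fixed_ne ι hι h2 τ hτι (fun x hx hvx => ?_) hD hz hu hw hτr hr
  obtain ⟨n, hn⟩ := heven x hx (fun h => by rw [h, map_zero] at hvx; exact (exp_ne_zero hvx.symm).elim)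
  rw [hvx, exp_inj] at hn
  omega

/-! ## §2 No `τ`-fixed uniformiser from residue approximation by `τ`-fixed integers (the local content of «`Fix(τ)` is unramified under `K`») -/

/-- **A `τ`-FIXED UNIFORMISER FORCES `τ = id`.**  `τ : K →+* K` isometric; if every integer of `K` is within distance `< 1` of a `τ`-FIXED integer (the residue field of `Fix τ` is all of
`k_K`) and some `τ`-fixed `π` has `|π| = exp(−1)`, then `|τm − m| ≤ exp(−k)` for every integer `m` and every `k` (write `m = c + π·m₁`, `τm − m = π·(τm₁ − m₁)`, induct), so `τ = id`.
Contrapositive, as used: `τ ≠ id` ⇒ NO `τ`-fixed element has valuation `exp(−1)`. [cite: Serre1979, Ch. I §6 Prop. 18; Ch. III §5 Thm. 3] -/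
theorem v_ne_exp_neg_one_of_fixed (τ : K →+* K) (hτv : ∀ x, Valued.v (τ x) = Valued.v x) {y : K} (hy : τ y ≠ y)
    (hres : ∀ m : K, Valued.v m ≤ 1 → ∃ c : K, τ c = c ∧ Valued.v c ≤ 1 ∧ Valued.v (m - c) < 1)
    {π : K} (hτπ : τ π = π) : Valued.v π ≠ exp (-1 : ℤ) := by
  intro hπ
  have hπ0 : π ≠ 0 := fun h => by rw [h, map_zero] at hπ; exact (exp_ne_zero hπ.symm).elim
  -- `|τ m − m| ≤ exp(−k)` for all integers `m`, by induction on `k`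
  have key : ∀ k : ℕ, ∀ m : K, Valued.v m ≤ 1 → Valued.v (τ m - m) ≤ exp (-(k : ℤ)) := by
    intro k
    induction k with
    | zero =>
      intro m hm
      rw [Nat.cast_zero, neg_zero, exp_zero]
      exact (Valuation.map_sub _ _ _).trans (max_le (by rw [hτv]; exact hm) hm)
    | succ k ih =>
      intro m hm
      obtain ⟨c, hτc, -, hmc⟩ := hres m hm
      have hδ : Valued.v (m - c) ≤ Valued.v π := by
        rw [hπ]
        rcases eq_or_ne (Valued.v (m - c)) 0 with h0 | h0
        · rw [h0]; exact zero_le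
        · rw [← exp_log h0, exp_le_exp]; rw [← exp_log h0, ← exp_zero, exp_lt_exp] at hmc; omega
      have hm₁ : Valued.v ((m - c) / π) ≤ 1 := by
        rw [map_div₀]; exact div_le_one_of_le₀ hδ zero_le
      have hsplit : τ m - m = π * (τ ((m - c) / π) - (m - c) / π) := by
        have : m = c + π * ((m - c) / π) := by field_simp; ring
        conv_lhs => rw [this]
        rw [map_add, map_mul, hτc, hτπ]; ring
      rw [hsplit, map_mul, hπ, Nat.cast_succ, neg_add, exp_add, mul_comm (exp (-(k : ℤ))) _]
      exact mul_le_mul_of_nonneg_left (ih _ hm₁) zero_le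
  -- scale `y` into the integers by a power of `π` and conclude `τ y = y`
  obtain ⟨N, hN⟩ : ∃ N : ℕ, Valued.v (π ^ N * y) ≤ 1 := by
    rcases eq_or_ne (Valued.v y) 0 with h0 | h0
    · exact ⟨0, by rw [pow_zero, one_mul, h0]; exact zero_le⟩
    · refine ⟨(log (Valued.v y)).toNat, ?_⟩
      have hcast : ((log (Valued.v y)).toNat : ℤ) ≥ log (Valued.v y) := Int.self_le_toNat _
      rw [map_mul, map_pow, hπ, ← exp_nsmul, ← exp_log h0, ← exp_add, ← exp_zero, exp_le_exp, smul_neg, nsmul_eq_mul, mul_one, log_exp]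
      omega
  have hτy : Valued.v (τ y - y) = 0 := by
    have hle : ∀ k : ℕ, Valued.v (π ^ N * (τ y - y)) ≤ exp (-(k : ℤ)) := fun k => by
      have h := key k _ hN
      rwa [map_mul, map_pow, hτπ, ← mul_sub] at h
    by_contra h0
    have h0' : Valued.v (π ^ N * (τ y - y)) ≠ 0 := by
      rw [map_mul, map_pow]; exact mul_ne_zero (pow_ne_zero _ (by rw [hπ]; exact exp_ne_zero)) h0
    have h := hle ((-(log (Valued.v (π ^ N * (τ y - y))))).toNat + 1)
    rw [← exp_log h0', exp_le_exp, log_exp] at h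
    omega
  exact hy (sub_eq_zero.1 ((map_eq_zero _).1 hτy))

end Valued

/-! ## §3 Residue approximation by `Θρ`-fixed integers on type (A) (the `hres` of §2, from a `Θρ`-fixed unit generator) -/

section Residue

variable {F E M : Type*} [Field F] [Field E] [Field M] [Valued E ℤᵐ⁰] [Valued M ℤᵐ⁰]

/-- **EVERY INTEGER OF `M` IS WITHIN `< 1` OF A `Θρ`-FIXED INTEGER (type (A)).**  Letters: `ι : F → E` with `σ ∘ ι = ι` and residue approximation along `ι` (`f = 1`, ★
`exists_valued_sub_toPlace_lt_one_of_ne_one`); `jE : E → M` isometric with `Fix ρ = jE(E)`, `Θ ∘ jE = jE ∘ σ`; a unit `α′` with `Θ(ρα′) = α′` and `|α′ − ρα′| = 1` (LH4-p14's generator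
`α′ = α·ρ(Θα)`).  Then `m = a + b·α′` with `b = (m − ρm)∕(α′ − ρα′)`, `a = m − bα′` both `ρ`-fixed integers, `a = jE a₀ ≡ jE(ι y_a)`, `b ≡ jE(ι y_b)` mod `𝔪`, and
`c := jE(ι y_a) + jE(ι y_b)·α′` is `Θρ`-fixed with `|m − c| < 1`. [cite: Serre1979, Ch. III §5 Thm. 3] [cite: NeukirchANT1999, Ch. II §4 Prop. (4.3)] -/
theorem exists_thetaRho_fixed_near (ι : F →+* E) (σ : E →+* E) (hσι : ∀ y, σ (ι y) = ι y)
    (hresE : ∀ x : E, Valued.v x ≤ 1 → ∃ y : F, Valued.v (ι y) ≤ 1 ∧ Valued.v (x - ι y) < 1)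
    (jE : E →+* M) (hjv : ∀ a, Valued.v (jE a) = Valued.v a) (ρ Θ : M →+* M)
    (hρρ : ∀ z, ρ (ρ z) = z) (hvρ : ∀ z, Valued.v (ρ z) = Valued.v z)
    (hjfix : ∀ z, ρ z = z ↔ ∃ a, jE a = z) (hΘj : ∀ a, Θ (jE a) = jE (σ a))
    {α' : M} (hτα' : Θ (ρ α') = α') (hα'1 : Valued.v α' ≤ 1) (hα' : Valued.v (α' - ρ α') = 1)
    (m : M) (hm : Valued.v m ≤ 1) : ∃ c : M, Θ (ρ c) = c ∧ Valued.v c ≤ 1 ∧ Valued.v (m - c) < 1 := by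
  have hd0 : α' - ρ α' ≠ 0 := fun h => by rw [h, map_zero] at hα'; exact zero_ne_one hα'
  set b : M := (m - ρ m) / (α' - ρ α') with hb
  set a : M := m - b * α' with ha
  clear_value b a
  have hρb : ρ b = b := by
    rw [hb, map_div₀, map_sub, map_sub, hρρ, hρρ, ← neg_sub m (ρ m), ← neg_sub α' (ρ α'), neg_div_neg_eq]
  have hρa : ρ a = a := by
    rw [ha, map_sub, map_mul, hρb]
    have : b * (α' - ρ α') = m - ρ m := by rw [hb]; field_simp
    linear_combination this
  have hvb : Valued.v b ≤ 1 := by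
    rw [hb, map_div₀, hα', div_one]
    exact (Valuation.map_sub _ _ _).trans (max_le hm (by rw [hvρ]; exact hm))
  have hva : Valued.v a ≤ 1 := by
    rw [ha]
    refine (Valuation.map_sub _ _ _).trans (max_le hm ?_)
    rw [map_mul]; exact mul_le_one' hvb hα'1
  obtain ⟨a₀, ha₀⟩ := (hjfix a).1 hρa
  obtain ⟨b₀, hb₀⟩ := (hjfix b).1 hρb
  obtain ⟨ya, hya1, hya⟩ := hresE a₀ (by rw [← hjv, ha₀]; exact hva)
  obtain ⟨yb, hyb1, hyb⟩ := hresE b₀ (by rw [← hjv, hb₀]; exact hvb)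
  have hρj : ∀ x : E, ρ (jE x) = jE x := fun x => (hjfix (jE x)).2 ⟨x, rfl⟩
  refine ⟨jE (ι ya) + jE (ι yb) * α', ?_, ?_, ?_⟩
  · rw [map_add, map_mul, map_add, map_mul, hρj, hρj, hτα', hΘj, hΘj, hσι, hσι]
  · refine (Valuation.map_add _ _ _).trans (max_le (by rw [hjv]; exact hya1) ?_)
    rw [map_mul]; exact mul_le_one' (by rw [hjv]; exact hyb1) hα'1
  · have hsplit : m - (jE (ι ya) + jE (ι yb) * α') = jE (a₀ - ι ya) + jE (b₀ - ι yb) * α' := by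
      rw [map_sub, map_sub, ha₀, hb₀, ha]; ring
    rw [hsplit]
    refine lt_of_le_of_lt (Valuation.map_add _ _ _) (max_lt (by rw [hjv]; exact hya) ?_)
    rw [map_mul]; exact mul_lt_one_of_nonneg_of_lt_one_left zero_le (by rw [hjv]; exact hyb) hα'1

/-- **THE GENERATOR `α′ := α·ρ(Θα)`** (LH4-p14 (g5)'s `thetaRhoFixed_generator`, re-derived here so that this file is self-contained): from `|α| ≤ 1`, `|α − ρα| = 1`, `|ρα − Θα| < 1`
and `|2| < 1` (wild place): `Θ(ρα′) = α′`, `|α′| ≤ 1`, `|α′ − ρα′| = 1`. [cite: Serre1979, Ch. III §5] -/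
theorem thetaRho_fixed_generator (ρ Θ : M →+* M) (hρρ : ∀ z, ρ (ρ z) = z) (hvρ : ∀ z, Valued.v (ρ z) = Valued.v z)
    (hΘΘ : ∀ z, Θ (Θ z) = z) (hΘρ : ∀ z, Θ (ρ z) = ρ (Θ z)) (hvΘ : ∀ z, Valued.v (Θ z) = Valued.v z)
    {α : M} (hα1 : Valued.v α ≤ 1) (hA : Valued.v (α - ρ α) = 1) (hτα : Valued.v (ρ α - Θ α) < 1) (h2 : Valued.v (2 : M) < 1) :
    Θ (ρ (α * ρ (Θ α))) = α * ρ (Θ α) ∧ Valued.v (α * ρ (Θ α)) ≤ 1 ∧ Valued.v (α * ρ (Θ α) - ρ (α * ρ (Θ α))) = 1 := by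
  refine ⟨?_, ?_, ?_⟩
  · rw [map_mul, map_mul, hρρ, hΘΘ, hΘρ, mul_comm]
  · rw [map_mul, hvρ, hvΘ]; exact mul_le_one' hα1 hα1
  · -- `α·ρΘα − ρα·Θα = (α − ρα)(α + ρα) + α·ρε − ρα·ε` with `ε := Θα − ρα`, `|ε| < 1`; and `|α + ρα| = |2α − (α − ρα)| = 1`
    have hsum : Valued.v (α + ρ α) = 1 := by
      have h2α : Valued.v (2 * α) < 1 := by rw [map_mul]; exact mul_lt_one_of_nonneg_of_lt_one_left zero_le h2 hα1
      have : α + ρ α = 2 * α - (α - ρ α) := by ring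
      rw [this, Valuation.map_sub_eq_of_lt_right _ (by rw [hA]; exact h2α), hA]
    have hε : Valued.v (Θ α - ρ α) < 1 := by rw [← Valuation.map_neg, neg_sub]; exact hτα
    have hmain : α * ρ (Θ α) - ρ (α * ρ (Θ α)) = (α - ρ α) * (α + ρ α) + (α * ρ (Θ α - ρ α) - ρ α * (Θ α - ρ α)) := by
      rw [map_mul, hρρ, map_sub, hρρ]; ring
    have hsmall : Valued.v (α * ρ (Θ α - ρ α) - ρ α * (Θ α - ρ α)) < 1 := by
      refine lt_of_le_of_lt (Valuation.map_sub _ _ _) (max_lt ?_ ?_)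
      · rw [map_mul, hvρ]; exact mul_lt_one_of_nonneg_of_lt_one_right hα1 zero_le hε
      · rw [map_mul, hvρ]; exact mul_lt_one_of_nonneg_of_lt_one_right hα1 zero_le hε
    have hbig : Valued.v ((α - ρ α) * (α + ρ α)) = 1 := by rw [map_mul, hA, hsum, one_mul]
    rw [hmain, Valuation.map_add_eq_of_lt_left _ (by rw [hbig]; exact hsmall), hbig]

end Residue

/-! ## Bridge: the datum in the `ValuativeRel` letters of ★ `hSide_closedForm_of_tube_exists` -/

section Bridge

open ValuativeRel
open scoped ValuativeRel

variable {F K : Type*} [Field F] [Field K] [Valued F ℤᵐ⁰] [ValuativeRel F] [(Valued.v : Valuation F ℤᵐ⁰).Compatible] [Valued K ℤᵐ⁰]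

/-- **(iii′) = (iii) with the datum in `ValuativeRel` letters** (parity letter in the weak form `τ x = x ⇒ |x| ≠ exp(−1)` of §2) (`valuation F u < 1`, `valuation F w = valuation F ϖ`, `|ϖ| = exp(−1)`), the shape of the EISENSTEIN disjunct of ★
`hSide_closedForm_of_tube_exists`. [cite: Serre1979, Ch. I §6 Prop. 17–18] -/
theorem false_of_eisensteinDatum_of_sq_of_fixed_ne (ι : F →+* K) (hι : ∀ y, Valued.v (ι y) = Valued.v y ^ 2) (h2 : (2 : K) ≠ 0)
    (τ : K →+* K) (hτι : ∀ y, τ (ι y) = ι y) (hodd : ∀ x : K, τ x = x → Valued.v x ≠ exp (-1 : ℤ))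
    {ϖ : F} (hϖ : Valued.v ϖ = exp (-1 : ℤ)) {D u w z : F} (hD : (u ^ 2 + 4 * w) * z ^ 2 = D) (hz : z ≠ 0)
    (hu : valuation F u < 1) (hw : valuation F w = valuation F ϖ) {r : K} (hτr : τ r = r) (hr : r ^ 2 = ι D) : False :=
  false_of_eisenstein_of_sq_of_fixed_ne ι hι h2 τ hτι hodd hD hz ((v_lt_one_iff_valuation_lt_one u).2 hu)
    (by rw [(v_eq_iff_valuation_eq w ϖ).2 hw, hϖ]) hτr hr

end Bridge


/-! ## §4 THE TYPE-(A) BRANCH KILL, COMPOSED (generic tower `F →ι E →jE M`; the head instantiates `ι = toPlace v w`, `jE = toPlace w.1 w₁`, `σ`, `ρ`, `Θ` at the CM place) -/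

section Kill

open ValuativeRel Matrix
open scoped ValuativeRel Matrix
open Summit.HodgeConjecture.HodgeConjecture.Cruxes.H413.F0P3cDyRamHSideDescentRatio Literature.NumberTheory.Automorphic.UnitaryGroup

variable {F E M : Type*} [Field F] [Field E] [Field M] [Valued F ℤᵐ⁰] [ValuativeRel F] [(Valued.v : Valuation F ℤᵐ⁰).Compatible]
  [Valued E ℤᵐ⁰] [Valued M ℤᵐ⁰]

/-- **ON TYPE (A) THE DESCENT DATUM OF THE `U(Φ₂)`-BLOCK IS NOT EISENSTEIN.**  Tower `F →ι E →jE M` with `|ι y| = |y|²` (`e(E∕F) = 2`), `σ ∘ ι = ι`, residue approximation along `ι`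
(`f(E∕F) = 1`), `σϖ ≠ ϖ`; `jE` isometric (`e(M∕E) = 1`, type U) with `Fix ρ = jE(E)`, `Θ ∘ jE = jE ∘ σ`, `ρ, Θ` commuting isometric involutions; the type-(A) letters `|α| ≤ 1`,
`|α − ρα| = 1`, `|ρα − Θα| < 1`, `|2| < 1` (and `2 ≠ 0`); the eigenvalue `lam` (`lam² = jE t·lam − jE D`, `ρlam = jE t − lam`, `Θlam·lam = 1`) of a block `U` (`tr U = t ≠ 0`,
`det U = D`, `D·σD = 1`, `t = D·σt`) descending as `diag(1, α_H)·U·diag(1, α_H)⁻¹ = s·ι(G)`; then NO Eisenstein datum `(u² + 4w)·z² = tr²G − 4det G`, `|u| < 1`, `|w| = |ϖ_F|`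
exists — ★ p09's `r₀ = μ − μ⁻¹` is a `Θρ`-fixed square root of `jE ι((u² + 4w)·z′²)` (`z′ = z·tr G∕det G`), and §1–§3 apply with `τ = Θρ`.  This refutes the EISENSTEIN disjunct of ★
`hSide_closedForm_of_tube_exists` on socket (A). [cite: Serre1979, Ch. I §6 Prop. 17–18; Ch. III §5 Thm. 3] [cite: LabesseLanglands1979, §2 p. 8] -/
theorem not_eisensteinDatum_typeA (ι : F →+* E) (hι2 : ∀ y, Valued.v (ι y) = Valued.v y ^ 2) (σ : E →+* E) (hσι : ∀ y, σ (ι y) = ι y)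
    (hresE : ∀ x : E, Valued.v x ≤ 1 → ∃ y : F, Valued.v (ι y) ≤ 1 ∧ Valued.v (x - ι y) < 1) {ϖ : E} (hσϖ : σ ϖ ≠ ϖ)
    (jE : E →+* M) (hjv : ∀ a, Valued.v (jE a) = Valued.v a) (ρ Θ : M →+* M)
    (hρρ : ∀ z, ρ (ρ z) = z) (hvρ : ∀ z, Valued.v (ρ z) = Valued.v z) (hjfix : ∀ z, ρ z = z ↔ ∃ a, jE a = z)
    (hΘj : ∀ a, Θ (jE a) = jE (σ a)) (hΘΘ : ∀ z, Θ (Θ z) = z) (hΘρ : ∀ z, Θ (ρ z) = ρ (Θ z)) (hvΘ : ∀ z, Valued.v (Θ z) = Valued.v z)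
    {α : M} (hα1 : Valued.v α ≤ 1) (hA : Valued.v (α - ρ α) = 1) (hτα : Valued.v (ρ α - Θ α) < 1)
    (h2 : Valued.v (2 : M) < 1) (h2ne : (2 : M) ≠ 0)
    {t D : E} {lam : M} (hlam2 : lam * lam = jE t * lam - jE D) (hρlam : ρ lam = jE t - lam) (hΘlam : Θ lam * lam = 1)
    (hDσ : D * σ D = 1) (ht0 : t ≠ 0)
    {U : Matrix (Fin 2) (Fin 2) E} (hUt : U.trace = t) (hUD : U.det = D)
    {αH s : E} {G : Matrix (Fin 2) (Fin 2) F} (hα0 : αH ≠ 0) (hs : s ≠ 0)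
    (hsg : Matrix.diagonal ![1, αH] * U * Matrix.diagonal ![1, αH⁻¹] = s • G.map ι) (hG : G.det ≠ 0)
    {ϖF : F} (hϖF : Valued.v ϖF = exp (-1 : ℤ)) {u w z : F} (hz : z ≠ 0) (hD : (u ^ 2 + 4 * w) * z ^ 2 = G.trace ^ 2 - 4 * G.det)
    (hu : valuation F u < 1) (hw : valuation F w = valuation F ϖF) : False := by
  -- non-vanishing letters
  have hlam0 : lam ≠ 0 := fun h => by rw [h, mul_zero] at hΘlam; exact zero_ne_one hΘlam
  have hD0 : D ≠ 0 := fun h => by rw [h, zero_mul] at hDσ; exact zero_ne_one hDσ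
  have hGt : G.trace ≠ 0 := by
    intro h0
    have h := trace_eq_smul_of_descent ι hα0 hsg
    rw [hUt, h0, map_zero, mul_zero] at h
    exact ht0 h
  have hρj : ∀ a : E, ρ (jE a) = jE a := fun a => (hjfix (jE a)).2 ⟨a, rfl⟩
  -- ★ p09: the `Θρ`-fixed square root `r₀ = μ − μ⁻¹`, `μ = lam∕ρlam`, of `jE ι((u² + 4w)·z′²)`
  have hτr : Θ (ρ (lam / ρ lam - (lam / ρ lam)⁻¹)) = lam / ρ lam - (lam / ρ lam)⁻¹ := map_map_ratioWitness_eq ρ Θ hΘlam hΘρ hρρ hlam0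
  have hr : (lam / ρ lam - (lam / ρ lam)⁻¹) ^ 2 = (jE.comp ι) ((u ^ 2 + 4 * w) * (z * G.trace / G.det) ^ 2) := by
    rw [ratioWitness_sq_eq jE ρ hlam2 hρlam hD0 hlam0, RingHom.comp_apply, disc_mul_sq_eq hD hG,
      ← discTraceSqDivDetSq_eq_map_of_descent ι hα0 hs hsg hG, hUt, hUD]
  -- §1–§3 with `τ = Θ ∘ ρ`, `ι_tot = jE ∘ ι`
  obtain ⟨hgen1, hgen2, hgen3⟩ := thetaRho_fixed_generator ρ Θ hρρ hvρ hΘΘ hΘρ hvΘ hα1 hA hτα h2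
  refine false_of_eisensteinDatum_of_sq_of_fixed_ne (jE.comp ι) (fun y => ?_) h2ne (Θ.comp ρ) (fun y => ?_) (fun x hx => ?_) hϖF rfl
    (div_ne_zero (mul_ne_zero hz hGt) hG) hu hw hτr hr
  · rw [RingHom.comp_apply, hjv, hι2]
  · rw [RingHom.comp_apply, RingHom.comp_apply, hρj, hΘj, hσι]
  · refine v_ne_exp_neg_one_of_fixed (Θ.comp ρ) (fun z' => by rw [RingHom.comp_apply, hvΘ, hvρ]) (y := jE ϖ) ?_ (fun m hm => ?_) hx
    · rw [RingHom.comp_apply, hρj, hΘj]; exact fun h => hσϖ (jE.injective h)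
    · obtain ⟨c, hc, hc1, hmc⟩ := exists_thetaRho_fixed_near ι σ hσι hresE jE hjv ρ Θ hρρ hvρ hjfix hΘj hgen1 hgen2 hgen3 m hm
      exact ⟨c, hc, hc1, hmc⟩

end Kill

end Summit.HodgeConjecture.HodgeConjecture.Cruxes.H413.F0P3cDyRamTypeASelector

end
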